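import Literature.Computability.QuantumComplexity.AaronsonAmbainisThm23Atoms
import Literature.Computability.Complexity.CHFormulas
import HarnessLib

/-!
# Aaronson–Ambainis 2014, Thm. 23 (machine half): the path-tuple sums are counting-hierarchy functions

Second machine-level file of the polynomial-time half of the proof of Thm. 23 (arXiv:0911.0996v3,
p. 14: the means, variances and influences of the restricted acceptance polynomial "are
computable in `P^{#P}`" / in the counting hierarchy). The integer sums of
`AaronsonAmbainisMoments.lean` — over quadruples of guessed coin strings, of a sign condition on the
final states times the consistency weight `[Cons]·2^{K − |freeIdx|}` of their oracle reads against
the node's restriction list `ρ` (and the flipped bit `i`) — are written here as FIRST-ORDER +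
COUNTING formulas over the `FP` atoms of `AaronsonAmbainisThm23Atoms.lean`, in the formula layer of
`Complexity/CHFormulas.lean`, on the left-nested record

  `⟨⟨⟨⟨W, c₀⟩, c₁⟩, c₂⟩, c₃⟩`,   `W = ⟨x, ⟨d, ⟨ρ̂, î⟩⟩⟩`

(`d = descFn x` carried along as a yardstick so that all quantifier ranges are lengths of fields,
`ρ̂` the coded restriction list — items `⟨bin j, b⟩` —, `î` the flip position, `c_s` the coin
strings). Contents: a Boolean layer and the length rule for the formula calculus; the `ρ`-atoms
(`RLive`, `RIdx`, `RBit` on `⟨ρ̂, bin m⟩`); the path atoms as predicates; `First`/`Free`; the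
consistency formulas `Cons1`, `Cons2`; the free-position count `FreeCnt`; the gate counts
`NGates`, `NHad`; the sign conditions `TPos`/`TNeg` of the pair terms; the guards; the summand
`gSummand` and the four nested exponential sums `sumS` — each with its membership in `CH`
(`IsCHFn` for the number-valued ones), ending in **`isCHFn_sumS`**. The meaning of these formulas
on coded inputs is the subject of the sequel. No named facts.

## References

* S. Aaronson, A. Ambainis, *The need for structure in quantum speedups*, Theory Comput. 10
  (2014), proof of Thm. 23 (arXiv:0911.0996v3, p. 14) [AaronsonAmbainis2014].
* J. Torán, *Complexity classes defined by counting quantifiers*, J. ACM 38 (1991), §4.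
* P. Bürgisser, ECCC TR06-113 (2006), §3 (the `FO + MAJ` calculus of `CH`-definable integers).
-/

noncomputable section

namespace Literature.Computability.QuantumComplexity

namespace Thm23Machine

open _root_.Computability Polynomial Complexity Complexity.Brick Complexity.Plumb Cryptography ADH Finset
open Complexity.PRelSigma Complexity.TTClosure Complexity.PPSharpP Complexity.ThresholdPP
open scoped Classical

attribute [-simp] Brick.nthF_zero Brick.sndPow_zero

/-! ### Additions to the formula layer -/

section DSL

variable {f g : List Bool → ℕ}

/-- Transport of `IsCHFn` along pointwise equality. [folklore] -/
theorem _root_.Literature.Computability.Complexity.IsCHFn.congr (hf : IsCHFn f) (h : ∀ w, f w = g w) : IsCHFn g := by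
  have : f = g := funext h
  rwa [← this]

/-- The full language is in `CH`. [folklore] -/
theorem top_mem_CH : ({_w | True} : Language Bool) ∈ CH := by
  have h : ({w | bitsToNat w = 0} : Language Bool) ∈ CH := P_subset_CH (valEqConst_mem_P 0)
  refine mem_CH_of_iff (union_mem_CH h (compl_mem_CH h)) _ fun w => ?_
  rw [memL_sup, memL_compl]
  change True ↔ bitsToNat w = 0 ∨ ¬ bitsToNat w = 0
  exact ⟨fun _ => em _, fun _ => trivial⟩

/-- **The length of an `FP` term is a `CH`-graph function.** [folklore] -/
theorem _root_.Literature.Computability.Complexity.IsCHFn.length_FP {t : List Bool → List Bool} (ht : t ∈ FP) :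
    IsCHFn fun w => (t w).length := by
  obtain ⟨s, hs⟩ := exists_poly_length_le_of_mem_FP ht
  have h1 : ({z | bitsToNat (sndP z) < (t (fstP z)).length} : Language Bool) ∈ Classes.P :=
    mem_P_of_iff (preimage_mem_P valLtLen_mem_P (pairFn_mem_FP (comp_mem_FP ht fstP_mem_FP) sndP_mem_FP)) _ fun z => by
      change bitsToNat (sndP z) < (t (fstP z)).length ↔
        bitsToNat (sndP (pairFn (t ∘ fstP) sndP z)) < (fstP (pairFn (t ∘ fstP) sndP z)).length
      rw [pairFn_apply, fstP_boolPair, sndP_boolPair]; rfl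
  -- `{z | val ν < |t w| + 1}` through `|t w ++ [1]| = |t w| + 1`
  have hm : ({z | bitsToNat (sndP z) < (t (fstP z) ++ [true]).length} : Language Bool) ∈ Classes.P :=
    mem_P_of_iff (preimage_mem_P valLtLen_mem_P (pairFn_mem_FP
      (comp_mem_FP OracleCompose.concatFn_mem_FP (pairFn_mem_FP (comp_mem_FP ht fstP_mem_FP) (const_mem_FP [true])))
      sndP_mem_FP)) _ fun z => by
      change bitsToNat (sndP z) < (t (fstP z) ++ [true]).length ↔
        bitsToNat (sndP (pairFn (OracleCompose.concatFn ∘ pairFn (t ∘ fstP) (fun _ => [true])) sndP z)) <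
          (fstP (pairFn (OracleCompose.concatFn ∘ pairFn (t ∘ fstP) (fun _ => [true])) sndP z)).length
      simp only [pairFn_apply, fstP_boolPair, sndP_boolPair, Function.comp_apply, OracleCompose.concatFn_boolPair]
  refine ⟨mem_CH_of_iff (P_subset_CH (inter_mem_P ((compl_mem_P_iff).2 h1) hm)) _ fun z => ?_, ⟨s + 1, fun w => ?_⟩⟩
  · rw [memL_inf', memL_compl]
    change (t (fstP z)).length = bitsToNat (sndP z) ↔
      ¬ bitsToNat (sndP z) < (t (fstP z)).length ∧ bitsToNat (sndP z) < (t (fstP z) ++ [true]).length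
    rw [List.length_append, List.length_singleton]
    constructor <;> intro h <;> omega
  · rw [eval_add, eval_one]
    exact (hs w).trans_lt (Nat.lt_two_pow_self.trans_le (Nat.pow_le_pow_right (by norm_num) (Nat.le_succ _)))

/-- A finite conjunction indexed by a list. [folklore] -/
theorem listAll_mem_CH {ι : Type*} {P : ι → List Bool → Prop} :
    ∀ (l : List ι), (∀ a ∈ l, ({w | P a w} : Language Bool) ∈ CH) → ({w | ∀ a ∈ l, P a w} : Language Bool) ∈ CH
  | [], _ => mem_CH_of_iff top_mem_CH _ fun w => by
      change (∀ a ∈ ([] : List ι), P a w) ↔ True; simp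
  | a :: l, h =>
    mem_CH_of_iff (and_mem_CH (h a (by simp)) (listAll_mem_CH l (fun a' ha' => h a' (by simp [ha'])))) _ fun w => by
      change (∀ a' ∈ a :: l, P a' w) ↔ P a w ∧ ∀ a' ∈ l, P a' w; simp

/-- A finite sum indexed by a list. [folklore] -/
theorem listSum_isCHFn {ι : Type*} {h : ι → List Bool → ℕ} :
    ∀ (l : List ι), (∀ a ∈ l, IsCHFn (h a)) → IsCHFn fun w => (l.map fun a => h a w).sum
  | [], _ => (IsCHFn.const 0).congr fun w => by simp
  | a :: l, hh => ((hh a (by simp)).add (listSum_isCHFn l fun a' ha' => hh a' (by simp [ha']))).congr fun w => by simp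

/-- `2 |fstP q| + |sndP q| ≤ |q|` (the total projections are the parts of `boolUnpair`; the twin in
`IntVectorBricks.lean` is not importable here without its arithmetic stack). [folklore] -/
private theorem two_mul_length_fstP_add_length_sndP_le' (q : List Bool) : 2 * (fstP q).length + (sndP q).length ≤ q.length :=
  length_boolUnpair_parts_le q

/-- **The sum rule, environment form, with the bound in the size of the paired word** (weaker
hypothesis than `IsCHFn.sum`: `g w v < 2^{q |⟨w, bin v⟩|}`). [cite: Burgisser2006, Theorem 3.7 (proof)] -/
theorem _root_.Literature.Computability.Complexity.IsCHFn.sum' {g : List Bool → ℕ → ℕ} (p : Polynomial ℕ)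
    (hg : IsCHFn fun z => g (fstP z) (bitsToNat (sndP z)))
    (hb : ∃ q : Polynomial ℕ, ∀ w v, g w v < 2 ^ q.eval (boolPair w (encodeNat v)).length) :
    IsCHFn fun w => ∑ v ∈ Finset.range (2 ^ p.eval w.length), g w v := by
  obtain ⟨q, hq⟩ := hb
  have hb' : ∀ z, (fun z => g (fstP z) (bitsToNat (sndP z))) z < 2 ^ (q.comp (X + X + X + 1 + 1)).eval z.length := fun z => by
    refine (hq _ _).trans_le (Nat.pow_le_pow_right (by norm_num) ?_)
    simp only [eval_comp, eval_add, eval_X, eval_one]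
    refine poly_eval_mono q ?_
    rw [length_boolPair]
    have h1 := length_fstP_le z
    have h2 : (encodeNat (bitsToNat (sndP z))).length ≤ (sndP z).length := length_encodeNat_bitsToNat_le _
    have h3 := two_mul_length_fstP_add_length_sndP_le' z
    omega
  have hG := sumGraph_mem_CH hg.graph hb' p
  refine ⟨mem_CH_of_iff hG _ fun z => ?_, ⟨p + (q.comp (X + X + X + 1 + 1)).comp (2 * X + 2 + p), fun w => ?_⟩⟩
  · change (∑ v ∈ Finset.range (2 ^ p.eval (fstP z).length), g (fstP z) v) = bitsToNat (sndP z) ↔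
      (∑ i ∈ Finset.range (2 ^ p.eval (fstP z).length),
        g (fstP (boolPair (fstP z) (encodeNat i))) (bitsToNat (sndP (boolPair (fstP z) (encodeNat i))))) = bitsToNat (sndP z)
    simp only [fstP_boolPair, sndP_boolPair, bitsToNat_encodeNat]
  · have := sum_lt_two_pow hb' p w
    simp only [fstP_boolPair, sndP_boolPair, bitsToNat_encodeNat] at this
    exact this

/-- **One nesting step**: if `h` is a `CH`-graph function then so is `w ↦ Σ_{v < 2^{|w|}} h ⟨w, bin v⟩`. [cite: Burgisser2006, Theorem 3.7 (proof)] -/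
theorem isCHFn_sum_pair {h : List Bool → ℕ} (hh : IsCHFn h) :
    IsCHFn fun w => ∑ v ∈ Finset.range (2 ^ (X : Polynomial ℕ).eval w.length), h (boolPair w (encodeNat v)) := by
  refine IsCHFn.sum' (g := fun w v => h (boolPair w (encodeNat v))) X ?_ ?_
  · exact (hh.comp_FP (pairFn_mem_FP fstP_mem_FP (comp_mem_FP norm_mem_FP sndP_mem_FP))).congr fun z => by
      simp [pairFn_apply, norm_eq_encodeNat]
  · obtain ⟨q, hq⟩ := hh.bound
    exact ⟨q, fun w v => hq _⟩

/-- The filtered range below a number has at most that many elements. [folklore] -/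
theorem card_filter_lt_le (B n : ℕ) (P : ℕ → Prop) [DecidablePred P] :
    ((Finset.range B).filter fun t => t < n ∧ P t).card ≤ n := by
  calc ((Finset.range B).filter fun t => t < n ∧ P t).card ≤ (Finset.range n).card :=
        Finset.card_le_card fun t ht => by simp only [Finset.mem_filter, Finset.mem_range] at ht ⊢; exact ht.2.1
    _ = n := Finset.card_range n

/-! #### Boolean-valued terms -/

variable {β₁ β₂ : List Bool → Bool}

/-- A decided `CH` predicate as a Boolean term. [folklore] -/
theorem bdecide_mem_CH {A : List Bool → Prop} [DecidablePred A] (hA : ({w | A w} : Language Bool) ∈ CH) :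
    ({w | decide (A w) = true} : Language Bool) ∈ CH :=
  mem_CH_of_iff hA _ fun w => by change decide (A w) = true ↔ A w; exact decide_eq_true_iff

/-- Conjunction of Boolean terms. [folklore] -/
theorem band_mem_CH (h₁ : ({w | β₁ w = true} : Language Bool) ∈ CH) (h₂ : ({w | β₂ w = true} : Language Bool) ∈ CH) :
    ({w | (β₁ w && β₂ w) = true} : Language Bool) ∈ CH :=
  mem_CH_of_iff (and_mem_CH h₁ h₂) _ fun w => by change (β₁ w && β₂ w) = true ↔ β₁ w = true ∧ β₂ w = true; exact Bool.and_eq_true_iff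

/-- Exclusive or of Boolean terms. [folklore] -/
theorem bxor_mem_CH (h₁ : ({w | β₁ w = true} : Language Bool) ∈ CH) (h₂ : ({w | β₂ w = true} : Language Bool) ∈ CH) :
    ({w | (β₁ w ^^ β₂ w) = true} : Language Bool) ∈ CH :=
  mem_CH_of_iff (not_mem_CH (iff_mem_CH h₁ h₂)) _ fun w => by
    change (β₁ w ^^ β₂ w) = true ↔ ¬ (β₁ w = true ↔ β₂ w = true)
    cases β₁ w <;> cases β₂ w <;> simp

/-- A constant Boolean term. [folklore] -/
theorem bconst_mem_CH (b : Bool) : ({_w | b = true} : Language Bool) ∈ CH := by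
  cases b
  · exact mem_CH_of_iff (not_mem_CH top_mem_CH) _ fun w => by change false = true ↔ ¬ True; simp
  · exact mem_CH_of_iff top_mem_CH _ fun w => by change true = true ↔ True; simp

/-- **Equality of two Boolean terms.** [folklore] -/
theorem beq_mem_CH (h₁ : ({w | β₁ w = true} : Language Bool) ∈ CH) (h₂ : ({w | β₂ w = true} : Language Bool) ∈ CH) :
    ({w | β₁ w = β₂ w} : Language Bool) ∈ CH :=
  mem_CH_of_iff (iff_mem_CH h₁ h₂) _ fun w => by
    change β₁ w = β₂ w ↔ (β₁ w = true ↔ β₂ w = true); exact Bool.eq_iff_iff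

end DSL

/-! ### The record and its accessors -/

section Access

/-- `W` of the record `⟨⟨⟨⟨W, c₀⟩, c₁⟩, c₂⟩, c₃⟩`. [folklore] -/
def wR : List Bool → List Bool := fstP ∘ fstP ∘ fstP ∘ fstP
/-- The coin string `c_s` (`s = 0, 1, 2, 3`). [folklore] -/
def coinR : ℕ → (List Bool → List Bool)
  | 0 => sndP ∘ fstP ∘ fstP ∘ fstP
  | 1 => sndP ∘ fstP ∘ fstP
  | 2 => sndP ∘ fstP
  | _ => sndP
/-- The input `x` (`W = ⟨x, ⟨d, ⟨ρ̂, î⟩⟩⟩`). [folklore] -/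
def xR : List Bool → List Bool := fstP ∘ wR
/-- The description `d`. [folklore] -/
def dR : List Bool → List Bool := fstP ∘ sndP ∘ wR
/-- The coded restriction list `ρ̂`. [folklore] -/
def rhoR : List Bool → List Bool := fstP ∘ sndP ∘ sndP ∘ wR
/-- The flip position `î`. [folklore] -/
def iR : List Bool → List Bool := sndP ∘ sndP ∘ sndP ∘ wR

/-- The accessors are in `FP`. [folklore] -/
theorem wR_mem_FP : wR ∈ FP := comp_mem_FP fstP_mem_FP (comp_mem_FP fstP_mem_FP (comp_mem_FP fstP_mem_FP fstP_mem_FP))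
/-- The accessors are in `FP`. [folklore] -/
theorem coinR_mem_FP : ∀ s, coinR s ∈ FP
  | 0 => show sndP ∘ (fstP ∘ (fstP ∘ fstP)) ∈ FP from
      comp_mem_FP (g := sndP) sndP_mem_FP (comp_mem_FP (g := fstP) fstP_mem_FP (comp_mem_FP (g := fstP) fstP_mem_FP fstP_mem_FP))
  | 1 => show sndP ∘ (fstP ∘ fstP) ∈ FP from
      comp_mem_FP (g := sndP) sndP_mem_FP (comp_mem_FP (g := fstP) fstP_mem_FP fstP_mem_FP)
  | 2 => show sndP ∘ fstP ∈ FP from comp_mem_FP (g := sndP) sndP_mem_FP fstP_mem_FP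
  | _ + 3 => sndP_mem_FP

/-- Projections never lengthen: `|dR R| ≤ |R|`, `|rhoR R| ≤ |R|`. [folklore] -/
theorem length_dR_le (R : List Bool) : (dR R).length ≤ R.length ∧ (rhoR R).length ≤ R.length := by
  have h1 := length_fstP_le R
  have h2 := length_fstP_le (fstP R)
  have h3 := length_fstP_le (fstP (fstP R))
  have h4 := length_fstP_le (fstP (fstP (fstP R)))
  have h5 := length_boolUnpair_parts_le (wR R)
  have h6 := length_boolUnpair_parts_le (sndP (wR R))
  have h7 := length_boolUnpair_parts_le (sndP (sndP (wR R)))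
  change 2 * (fstP (wR R)).length + (sndP (wR R)).length ≤ (wR R).length at h5
  change 2 * (fstP (sndP (wR R))).length + (sndP (sndP (wR R))).length ≤ (sndP (wR R)).length at h6
  change 2 * (fstP (sndP (sndP (wR R)))).length + (sndP (sndP (sndP (wR R)))).length ≤ (sndP (sndP (wR R))).length at h7
  simp only [dR, rhoR, wR, Function.comp_apply] at *
  omega
/-- The accessors are in `FP`. [folklore] -/
theorem xR_mem_FP : xR ∈ FP := comp_mem_FP fstP_mem_FP wR_mem_FP
/-- The accessors are in `FP`. [folklore] -/
theorem dR_mem_FP : dR ∈ FP := comp_mem_FP fstP_mem_FP (comp_mem_FP sndP_mem_FP wR_mem_FP)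
/-- The accessors are in `FP`. [folklore] -/
theorem rhoR_mem_FP : rhoR ∈ FP := comp_mem_FP fstP_mem_FP (comp_mem_FP sndP_mem_FP (comp_mem_FP sndP_mem_FP wR_mem_FP))
/-- The accessors are in `FP`. [folklore] -/
theorem iR_mem_FP : iR ∈ FP := comp_mem_FP sndP_mem_FP (comp_mem_FP sndP_mem_FP (comp_mem_FP sndP_mem_FP wR_mem_FP))

/-- The record of `W` and four coin strings. [folklore] -/
def mkR (W c₀ c₁ c₂ c₃ : List Bool) : List Bool := boolPair (boolPair (boolPair (boolPair W c₀) c₁) c₂) c₃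

/-- Reading the record. [folklore] -/
@[simp] theorem access_mkR (x d ρh ih c₀ c₁ c₂ c₃ : List Bool) :
    wR (mkR (boolPair x (boolPair d (boolPair ρh ih))) c₀ c₁ c₂ c₃) = boolPair x (boolPair d (boolPair ρh ih)) ∧
    xR (mkR (boolPair x (boolPair d (boolPair ρh ih))) c₀ c₁ c₂ c₃) = x ∧
    dR (mkR (boolPair x (boolPair d (boolPair ρh ih))) c₀ c₁ c₂ c₃) = d ∧
    rhoR (mkR (boolPair x (boolPair d (boolPair ρh ih))) c₀ c₁ c₂ c₃) = ρh ∧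
    iR (mkR (boolPair x (boolPair d (boolPair ρh ih))) c₀ c₁ c₂ c₃) = ih ∧
    coinR 0 (mkR (boolPair x (boolPair d (boolPair ρh ih))) c₀ c₁ c₂ c₃) = c₀ ∧
    coinR 1 (mkR (boolPair x (boolPair d (boolPair ρh ih))) c₀ c₁ c₂ c₃) = c₁ ∧
    coinR 2 (mkR (boolPair x (boolPair d (boolPair ρh ih))) c₀ c₁ c₂ c₃) = c₂ ∧
    coinR 3 (mkR (boolPair x (boolPair d (boolPair ρh ih))) c₀ c₁ c₂ c₃) = c₃ := by
  simp [wR, xR, dR, rhoR, iR, coinR, mkR]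

end Access

/-! ### The `ρ`-atoms -/

section Rho

/-- On `⟨ρ̂, bin m⟩`: entry `m` exists (the coded list has more than `m` items; `ρ̂` is its own yardstick). [folklore] -/
def liveRF : List Bool → List Bool := notFn (nilT (dropLF ∘ pairFn fstP (pairFn sndP fstP)))
/-- On `⟨ρ̂, bin m⟩`: item `m`, a pair `⟨bin j, b⟩`. [folklore] -/
def itemRF : List Bool → List Bool := nthLF ∘ pairFn fstP (pairFn sndP fstP)
/-- On `⟨ρ̂, bin m⟩`: the index numeral of entry `m`. [folklore] -/
def ridxRF : List Bool → List Bool := fstF ∘ itemRF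
/-- On `⟨ρ̂, bin m⟩`: the bit of entry `m`, one bit. [folklore] -/
def rbitRF : List Bool → List Bool := bitT (sndF ∘ itemRF)

/-- The `ρ`-atoms are in `FP`. [folklore] -/
theorem rhoAtoms_mem_FP : liveRF ∈ FP ∧ itemRF ∈ FP ∧ ridxRF ∈ FP ∧ rbitRF ∈ FP := by
  have harg : pairFn fstP (pairFn sndP fstP) ∈ FP := pairFn_mem_FP fstP_mem_FP (pairFn_mem_FP sndP_mem_FP fstP_mem_FP)
  have hi : itemRF ∈ FP := comp_mem_FP nthLF_mem_FP harg
  exact ⟨notFn_mem_FP (nilT_mem_FP (comp_mem_FP dropLF_mem_FP harg)), hi, comp_mem_FP fstF_mem_FP hi,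
    bitT_mem_FP (comp_mem_FP sndF_mem_FP hi)⟩

/-- Entry `m` of `ρ̂` exists. [folklore] -/
def RLive (ρh : List Bool) (m : ℕ) : Prop := liveRF (boolPair ρh (encodeNat m)) = [true]
/-- The index of entry `m` of `ρ̂`. [folklore] -/
def RIdx (ρh : List Bool) (m : ℕ) : ℕ := bitsToNat (ridxRF (boolPair ρh (encodeNat m)))
/-- The bit of entry `m` of `ρ̂` is `1`. [folklore] -/
def RBit (ρh : List Bool) (m : ℕ) : Prop := rbitRF (boolPair ρh (encodeNat m)) = [true]

end Rho

/-! ### The path atoms as predicates and functions of `(x, c, t)` -/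

section Path

variable (F : QCircuitFamily cliffordT)

/-- Gate `t` exists. [folklore] -/
def PLive (x c : List Bool) (t : ℕ) : Prop := liveT F (boolPair x (boolPair c (encodeNat t))) = [true]
/-- Gate `t` is an oracle gate (a read happens in round `t`). [folklore] -/
def PRead (x c : List Bool) (t : ℕ) : Prop := orcT F (boolPair x (boolPair c (encodeNat t))) = [true]
/-- Gate `t` is a Hadamard gate. [folklore] -/
def PHad (x c : List Bool) (t : ℕ) : Prop := hadT F (boolPair x (boolPair c (encodeNat t))) = [true]
/-- The canonical number of the query of round `t`. [folklore] -/
def PIdx (x c : List Bool) (t : ℕ) : ℕ := bitsToNat (idxF F (boolPair x (boolPair c (encodeNat t))))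
/-- The coin (guessed answer) of round `t` is `1`. [folklore] -/
def PVal (x c : List Bool) (t : ℕ) : Prop := coinT F (boolPair x (boolPair c (encodeNat t))) = [true]
/-- The final state of the coins `c` is valid. [folklore] -/
def PVld (x c : List Bool) : Prop := vldT F (boolPair x c) = [true]
/-- The final state accepts (wire `0` reads `1`). [folklore] -/
def PAcc (x c : List Bool) : Prop := acpT F (boolPair x c) = [true]

end Path

/-! ### The formulas -/

section Formulas

variable (F : QCircuitFamily cliffordT)

/-- `m` is the FIRST entry of `ρ̂` at index `j`. [folklore] -/
def First (ρh : List Bool) (j m : ℕ) : Prop := RLive ρh m ∧ RIdx ρh m = j ∧ ∀ m' < m, RIdx ρh m' ≠ j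

/-- Index `j` is free: no entry of `ρ̂` (among the first `|ρ̂|`) is at `j`. [folklore] -/
def Free (ρh : List Bool) (j : ℕ) : Prop := ∀ m < ρh.length, RLive ρh m → RIdx ρh m ≠ j

/-- **Consistency, part 1** (slot `s`): every read at an overridden position guesses the
prescribed bit. On the record `R`. [cite: AaronsonAmbainis2014, proof of Thm. 23 (p. 14)] -/
def Cons1 (s : ℕ) (R : List Bool) : Prop :=
  ∀ t < (dR R).length, PRead F (xR R) (coinR s R) t →
    ∀ m < (rhoR R).length, First (rhoR R) (PIdx F (xR R) (coinR s R) t) m →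
      (PVal F (xR R) (coinR s R) t ↔ RBit (rhoR R) m)

/-- The flip tag of slot `s` (slots `2, 3` are flipped iff `fl`). [folklore] -/
def flS (fl : Bool) (s : ℕ) : Bool := fl && decide (2 ≤ s)

/-- The guessed bit of a read, corrected by the flip at the flip position: the bit the read forces
on the random oracle (`OracleReads.forcedVal`). [folklore] -/
def forcedB (fl : Bool) (s : ℕ) (R : List Bool) (t : ℕ) : Bool :=
  decide (PVal F (xR R) (coinR s R) t) ^^ (flS fl s && decide (PIdx F (xR R) (coinR s R) t = bitsToNat (iR R)))

/-- **Consistency, part 2** (slots `s, s'`): free reads of the same position force the same bit. [cite: AaronsonAmbainis2014, proof of Thm. 23 (p. 14)] -/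
def Cons2 (fl : Bool) (s s' : ℕ) (R : List Bool) : Prop :=
  ∀ t < (dR R).length, ∀ t' < (dR R).length, PRead F (xR R) (coinR s R) t → PRead F (xR R) (coinR s' R) t' →
    Free (rhoR R) (PIdx F (xR R) (coinR s R) t) → PIdx F (xR R) (coinR s R) t = PIdx F (xR R) (coinR s' R) t' →
      forcedB F fl s R t = forcedB F fl s' R t'

/-- **Consistency** of the reads of the slots `σ`. [cite: AaronsonAmbainis2014, proof of Thm. 23 (p. 14)] -/
def ConsAll (fl : Bool) (σ : List ℕ) (R : List Bool) : Prop :=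
  (∀ s ∈ σ, Cons1 F s R) ∧ ∀ s ∈ σ, ∀ s' ∈ σ, Cons2 F fl s s' R

/-- A read `(s, t)` is a NEW free position: free, and no earlier read (earlier slot, or same slot
and earlier round) of the slots `σ` is at the same position. [folklore] -/
def NewFree (σ : List ℕ) (s : ℕ) (R : List Bool) (t : ℕ) : Prop :=
  PRead F (xR R) (coinR s R) t ∧ Free (rhoR R) (PIdx F (xR R) (coinR s R) t) ∧
    (∀ s' ∈ σ, s' < s → ∀ t' < (dR R).length, PRead F (xR R) (coinR s' R) t' →
      PIdx F (xR R) (coinR s' R) t' ≠ PIdx F (xR R) (coinR s R) t) ∧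
    ∀ t' < t, PRead F (xR R) (coinR s R) t' → PIdx F (xR R) (coinR s R) t' ≠ PIdx F (xR R) (coinR s R) t

/-- **The number of distinct free positions read** by the slots `σ` (`|freeIdx|`). [cite: AaronsonAmbainis2014, proof of Thm. 23 (p. 14)] -/
def FreeCnt (σ : List ℕ) (R : List Bool) : ℕ :=
  (σ.map fun s => ((range (2 ^ (X : Polynomial ℕ).eval R.length)).filter
    fun t => t < (dR R).length ∧ NewFree F σ s R t).card).sum

/-- **The number of gates** `μ`. [folklore] -/
def NGates (R : List Bool) : ℕ :=
  ((range (2 ^ (X : Polynomial ℕ).eval R.length)).filter fun t => t < (dR R).length ∧ PLive F (xR R) (coinR 0 R) t).card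

/-- **The number of Hadamard gates** `h`. [folklore] -/
def NHad (R : List Bool) : ℕ :=
  ((range (2 ^ (X : Polynomial ℕ).eval R.length)).filter fun t => t < (dR R).length ∧ PHad F (xR R) (coinR 0 R) t).card

/-- **The number of oracle gates** (half the degree bound). [folklore] -/
def NOrc (R : List Bool) : ℕ :=
  ((range (2 ^ (X : Polynomial ℕ).eval R.length)).filter fun t => t < (dR R).length ∧ PRead F (xR R) (coinR 0 R) t).card

/-- Both final states are valid, end at the same label, and accept. [folklore] -/
def Meet (s₀ s₁ : ℕ) (R : List Bool) : Prop :=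
  PVld F (xR R) (coinR s₀ R) ∧ PVld F (xR R) (coinR s₁ R) ∧
    labF F (boolPair (xR R) (coinR s₀ R)) = labF F (boolPair (xR R) (coinR s₁ R)) ∧ PAcc F (xR R) (coinR s₀ R)

/-- The phase of slot `s₀` is the phase of slot `s₁` plus `k` (mod `8`). [folklore] -/
def PhEq (k : ℕ) (s₀ s₁ : ℕ) (R : List Bool) : Prop :=
  phkF F 0 (boolPair (xR R) (coinR s₀ R)) = phkF F k (boolPair (xR R) (coinR s₁ R))

/-- **The pair term of slots `s₀, s₁` is `+1`** (`ab = A`: `reA`, class `0`; `ab = B`: `reB`, classes `1, 7`). [cite: AdlemanDeMarraisHuang1997, §6 Lemma 6.10] -/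
def TPos (isB : Bool) (s₀ s₁ : ℕ) (R : List Bool) : Prop :=
  Meet F s₀ s₁ R ∧ if isB then (PhEq F 1 s₀ s₁ R ∨ PhEq F 7 s₀ s₁ R) else PhEq F 0 s₀ s₁ R

/-- **The pair term of slots `s₀, s₁` is `−1`** (`reA`: class `4`; `reB`: classes `3, 5`). [cite: AdlemanDeMarraisHuang1997, §6 Lemma 6.10] -/
def TNeg (isB : Bool) (s₀ s₁ : ℕ) (R : List Bool) : Prop :=
  Meet F s₀ s₁ R ∧ if isB then (PhEq F 3 s₀ s₁ R ∨ PhEq F 5 s₀ s₁ R) else PhEq F 4 s₀ s₁ R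

/-- The kind of a sum: pair (`quad = false`: term of slots `0,1`, reads of slots `0,1`, scale `2μ`)
or quadruple (term `t_X(0,1)·t_Y(2,3)`, reads of all slots, scale `4μ`), the letters `X, Y` and
the flip bit. [folklore] -/
structure Kind where
  /-- quadruple sum? -/
  quad : Bool
  /-- first letter is `B`? -/
  bX : Bool
  /-- second letter is `B`? -/
  bY : Bool
  /-- slots `2, 3` read the flipped view? -/
  fl : Bool

/-- The slots whose reads count. [folklore] -/
def Kind.slots (κ : Kind) : List ℕ := if κ.quad then [0, 1, 2, 3] else [0, 1]

/-- The scale factor `K/μ`. [folklore] -/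
def Kind.kfac (κ : Kind) : ℕ := if κ.quad then 4 else 2

/-- **The sign condition**: the (product) term is `+1` (`pos`) resp. `−1`. [folklore] -/
def TSign (κ : Kind) (pos : Bool) (R : List Bool) : Prop :=
  if κ.quad then
    if pos then (TPos F κ.bX 0 1 R ∧ TPos F κ.bY 2 3 R) ∨ (TNeg F κ.bX 0 1 R ∧ TNeg F κ.bY 2 3 R)
    else (TPos F κ.bX 0 1 R ∧ TNeg F κ.bY 2 3 R) ∨ (TNeg F κ.bX 0 1 R ∧ TPos F κ.bY 2 3 R)
  else if pos then TPos F κ.bX 0 1 R else TNeg F κ.bX 0 1 R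

/-- **The guards**: every coin string is a number below `2^μ`. [folklore] -/
def Guard (R : List Bool) : Prop := ∀ s ∈ [0, 1, 2, 3], bitsToNat (coinR s R) < 2 ^ NGates F R

open scoped Classical in
/-- **The summand**: `2^{K − |free|}` on the guarded, signed, consistent records, else `0`. [cite: AaronsonAmbainis2014, proof of Thm. 23 (p. 14)] -/
def gSummand (κ : Kind) (pos : Bool) (R : List Bool) : ℕ :=
  if Guard F R ∧ TSign F κ pos R ∧ ConsAll F κ.fl κ.slots R then 2 ^ (κ.kfac * NGates F R - FreeCnt F κ.slots R) else 0

/-- The innermost sum, over `c₃ = bin v₃`. [folklore] -/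
def sumS3 (κ : Kind) (pos : Bool) (w : List Bool) : ℕ :=
  ∑ v ∈ range (2 ^ (X : Polynomial ℕ).eval w.length), gSummand F κ pos (boolPair w (encodeNat v))
/-- The sum over `c₂, c₃`. [folklore] -/
def sumS2 (κ : Kind) (pos : Bool) (w : List Bool) : ℕ :=
  ∑ v ∈ range (2 ^ (X : Polynomial ℕ).eval w.length), sumS3 F κ pos (boolPair w (encodeNat v))
/-- The sum over `c₁, c₂, c₃`. [folklore] -/
def sumS1 (κ : Kind) (pos : Bool) (w : List Bool) : ℕ :=
  ∑ v ∈ range (2 ^ (X : Polynomial ℕ).eval w.length), sumS2 F κ pos (boolPair w (encodeNat v))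
/-- **The sum** of kind `κ` and sign `pos`, on `W = ⟨x, ⟨d, ⟨ρ̂, î⟩⟩⟩`: over all quadruples of
coin numerals. [cite: AaronsonAmbainis2014, proof of Thm. 23 (p. 14)] -/
def sumS (κ : Kind) (pos : Bool) (W : List Bool) : ℕ :=
  ∑ v ∈ range (2 ^ (X : Polynomial ℕ).eval W.length), sumS1 F κ pos (boolPair W (encodeNat v))

end Formulas

/-! ### Membership in the counting hierarchy -/

section Membership

variable {F : QCircuitFamily cliffordT} (hU : F.IsUniform)
include hU

/-- The path atoms, read at `FP`-computed arguments, are `CH` predicates / functions. [folklore] -/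
theorem pathAtoms_mem_CH {ax ac at_ : List Bool → List Bool} (hx : ax ∈ FP) (hc : ac ∈ FP) (ht : at_ ∈ FP) :
    ({w | PLive F (ax w) (ac w) (bitsToNat (at_ w))} : Language Bool) ∈ CH ∧
    ({w | PRead F (ax w) (ac w) (bitsToNat (at_ w))} : Language Bool) ∈ CH ∧
    ({w | PHad F (ax w) (ac w) (bitsToNat (at_ w))} : Language Bool) ∈ CH ∧
    ({w | PVal F (ax w) (ac w) (bitsToNat (at_ w))} : Language Bool) ∈ CH ∧
    IsCHFn (fun w => PIdx F (ax w) (ac w) (bitsToNat (at_ w))) := by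
  obtain ⟨-, -, -, -, hlive, horc, hhad, hcoin, -, hidx⟩ := atoms_mem_FP hU
  have harg : pairFn ax (pairFn ac (norm ∘ at_)) ∈ FP := pairFn_mem_FP hx (pairFn_mem_FP hc (comp_mem_FP norm_mem_FP ht))
  have key : ∀ w, pairFn ax (pairFn ac (norm ∘ at_)) w = boolPair (ax w) (boolPair (ac w) (encodeNat (bitsToNat (at_ w)))) := by
    intro w; simp [pairFn_apply, norm_eq_encodeNat]
  refine ⟨?_, ?_, ?_, ?_, ?_⟩
  · exact mem_CH_of_iff (pred_comp_FP_mem_CH (fpTest_mem_CH hlive) harg) _ fun w => by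
      change _ ↔ liveT F (pairFn ax (pairFn ac (norm ∘ at_)) w) = [true]; rw [key]; rfl
  · exact mem_CH_of_iff (pred_comp_FP_mem_CH (fpTest_mem_CH horc) harg) _ fun w => by
      change _ ↔ orcT F (pairFn ax (pairFn ac (norm ∘ at_)) w) = [true]; rw [key]; rfl
  · exact mem_CH_of_iff (pred_comp_FP_mem_CH (fpTest_mem_CH hhad) harg) _ fun w => by
      change _ ↔ hadT F (pairFn ax (pairFn ac (norm ∘ at_)) w) = [true]; rw [key]; rfl
  · exact mem_CH_of_iff (pred_comp_FP_mem_CH (fpTest_mem_CH hcoin) harg) _ fun w => by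
      change _ ↔ coinT F (pairFn ax (pairFn ac (norm ∘ at_)) w) = [true]; rw [key]; rfl
  · exact ((IsCHFn.of_FP hidx).comp_FP harg).congr fun w => by simp only [key]; rfl

/-- The final-state atoms at `FP`-computed arguments are `CH` predicates. [folklore] -/
theorem finalAtoms_mem_CH {ax ac : List Bool → List Bool} (hx : ax ∈ FP) (hc : ac ∈ FP) :
    ({w | PVld F (ax w) (ac w)} : Language Bool) ∈ CH ∧ ({w | PAcc F (ax w) (ac w)} : Language Bool) ∈ CH := by
  obtain ⟨hv, -, ha, -⟩ := atoms_mem_FP hU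
  have harg : pairFn ax ac ∈ FP := pairFn_mem_FP hx hc
  exact ⟨mem_CH_of_iff (pred_comp_FP_mem_CH (fpTest_mem_CH hv) harg) _ fun w => by
      change _ ↔ vldT F (pairFn ax ac w) = [true]; rw [pairFn_apply]; rfl,
    mem_CH_of_iff (pred_comp_FP_mem_CH (fpTest_mem_CH ha) harg) _ fun w => by
      change _ ↔ acpT F (pairFn ax ac w) = [true]; rw [pairFn_apply]; rfl⟩

omit hU in
/-- The `ρ`-atoms at `FP`-computed arguments are `CH` predicates / functions. [folklore] -/
theorem rhoAtoms_mem_CH {aρ am : List Bool → List Bool} (hρ : aρ ∈ FP) (hm : am ∈ FP) :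
    ({w | RLive (aρ w) (bitsToNat (am w))} : Language Bool) ∈ CH ∧
    IsCHFn (fun w => RIdx (aρ w) (bitsToNat (am w))) ∧
    ({w | RBit (aρ w) (bitsToNat (am w))} : Language Bool) ∈ CH := by
  obtain ⟨hl, -, hi, hb⟩ := rhoAtoms_mem_FP
  have harg : pairFn aρ (norm ∘ am) ∈ FP := pairFn_mem_FP hρ (comp_mem_FP norm_mem_FP hm)
  have key : ∀ w, pairFn aρ (norm ∘ am) w = boolPair (aρ w) (encodeNat (bitsToNat (am w))) := by
    intro w; simp [pairFn_apply, norm_eq_encodeNat]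
  exact ⟨mem_CH_of_iff (pred_comp_FP_mem_CH (fpTest_mem_CH hl) harg) _ fun w => by
      change _ ↔ liveRF (pairFn aρ (norm ∘ am) w) = [true]; rw [key]; rfl,
    ((IsCHFn.of_FP hi).comp_FP harg).congr fun w => by simp only [key]; rfl,
    mem_CH_of_iff (pred_comp_FP_mem_CH (fpTest_mem_CH hb) harg) _ fun w => by
      change _ ↔ rbitRF (pairFn aρ (norm ∘ am) w) = [true]; rw [key]; rfl⟩

omit hU in
/-- **`First` at `FP`/`CH`-computed arguments is a `CH` predicate.** [folklore] -/
theorem first_mem_CH {aρ : List Bool → List Bool} (hρ : aρ ∈ FP) {J : List Bool → ℕ} (hJ : IsCHFn J)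
    {am : List Bool → List Bool} (hm : am ∈ FP) :
    ({w | First (aρ w) (J w) (bitsToNat (am w))} : Language Bool) ∈ CH := by
  obtain ⟨hl, hi, -⟩ := rhoAtoms_mem_CH hρ hm
  -- `∀ m' < m, RIdx ρ̂ m' ≠ J`: body on `⟨w, bin m'⟩`
  obtain ⟨-, hi', -⟩ := rhoAtoms_mem_CH (comp_mem_FP hρ fstP_mem_FP) sndP_mem_FP
  have hall := forall_lt_fn_mem_CH (Φ := fun w m' => RIdx (aρ w) m' ≠ J w) (IsCHFn.of_FP hm)
    (not_mem_CH (IsCHFn.eq_mem_CH hi' (hJ.comp_FP fstP_mem_FP)))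
  exact and_mem_CH hl (and_mem_CH (IsCHFn.eq_mem_CH hi hJ) hall)

omit hU in
/-- **`Free` at `FP`/`CH`-computed arguments is a `CH` predicate.** [folklore] -/
theorem free_mem_CH {aρ : List Bool → List Bool} (hρ : aρ ∈ FP) {J : List Bool → ℕ} (hJ : IsCHFn J) :
    ({w | Free (aρ w) (J w)} : Language Bool) ∈ CH := by
  obtain ⟨hl, hi, -⟩ := rhoAtoms_mem_CH (comp_mem_FP hρ fstP_mem_FP) sndP_mem_FP
  exact forall_lt_fn_mem_CH (Φ := fun w m => RLive (aρ w) m → RIdx (aρ w) m ≠ J w) (IsCHFn.length_FP hρ)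
    (imp_mem_CH hl (not_mem_CH (IsCHFn.eq_mem_CH hi (hJ.comp_FP fstP_mem_FP))))

/-- **`Cons1 s` is a `CH` predicate.** [cite: AaronsonAmbainis2014, proof of Thm. 23 (p. 14)] -/
theorem cons1_mem_CH (s : ℕ) : ({R | Cons1 F s R} : Language Bool) ∈ CH := by
  -- level 2, on `z₂ = ⟨⟨R, bin t⟩, bin m⟩`
  have hR2 : xR ∘ fstP ∘ fstP ∈ FP := comp_mem_FP xR_mem_FP (comp_mem_FP fstP_mem_FP fstP_mem_FP)
  have hC2 : coinR s ∘ fstP ∘ fstP ∈ FP := comp_mem_FP (coinR_mem_FP s) (comp_mem_FP fstP_mem_FP fstP_mem_FP)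
  have hT2 : sndP ∘ fstP ∈ FP := comp_mem_FP sndP_mem_FP fstP_mem_FP
  have hρ2 : rhoR ∘ fstP ∘ fstP ∈ FP := comp_mem_FP rhoR_mem_FP (comp_mem_FP fstP_mem_FP fstP_mem_FP)
  obtain ⟨-, -, -, hval2, hidx2⟩ := pathAtoms_mem_CH hU hR2 hC2 hT2
  obtain ⟨-, -, hbit2⟩ := rhoAtoms_mem_CH hρ2 sndP_mem_FP
  have hfirst2 := first_mem_CH hρ2 hidx2 sndP_mem_FP
  have hbody2 : ({z | First ((rhoR ∘ fstP ∘ fstP) z) (PIdx F ((xR ∘ fstP ∘ fstP) z) ((coinR s ∘ fstP ∘ fstP) z) (bitsToNat ((sndP ∘ fstP) z)))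
      (bitsToNat (sndP z)) → (PVal F ((xR ∘ fstP ∘ fstP) z) ((coinR s ∘ fstP ∘ fstP) z) (bitsToNat ((sndP ∘ fstP) z)) ↔
        RBit ((rhoR ∘ fstP ∘ fstP) z) (bitsToNat (sndP z)))} : Language Bool) ∈ CH :=
    imp_mem_CH hfirst2 (iff_mem_CH hval2 hbit2)
  -- level 1, on `z₁ = ⟨R, bin t⟩`
  have hρ1 : rhoR ∘ fstP ∈ FP := comp_mem_FP rhoR_mem_FP fstP_mem_FP
  have hall1 := forall_lt_fn_mem_CH (Φ := fun z₁ m => First (rhoR (fstP z₁)) (PIdx F (xR (fstP z₁)) (coinR s (fstP z₁)) (bitsToNat (sndP z₁))) m →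
      (PVal F (xR (fstP z₁)) (coinR s (fstP z₁)) (bitsToNat (sndP z₁)) ↔ RBit (rhoR (fstP z₁)) m))
    (IsCHFn.length_FP hρ1) hbody2
  obtain ⟨-, hread1, -⟩ := pathAtoms_mem_CH hU (comp_mem_FP xR_mem_FP fstP_mem_FP) (comp_mem_FP (coinR_mem_FP s) fstP_mem_FP) sndP_mem_FP
  have hbody1 := imp_mem_CH hread1 hall1
  -- level 0
  exact forall_lt_fn_mem_CH (Φ := fun R t => PRead F (xR R) (coinR s R) t → ∀ m < (rhoR R).length,
      First (rhoR R) (PIdx F (xR R) (coinR s R) t) m → (PVal F (xR R) (coinR s R) t ↔ RBit (rhoR R) m))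
    (IsCHFn.length_FP (t := dR) dR_mem_FP) hbody1

/-- The forced bit at `FP`-computed arguments is a Boolean `CH` term. [folklore] -/
theorem forcedB_mem_CH (fl : Bool) (s : ℕ) {aR at_ : List Bool → List Bool} (hR : aR ∈ FP) (ht : at_ ∈ FP) :
    ({w | forcedB F fl s (aR w) (bitsToNat (at_ w)) = true} : Language Bool) ∈ CH := by
  obtain ⟨-, -, -, hval, hidx⟩ := pathAtoms_mem_CH hU (comp_mem_FP xR_mem_FP hR) (comp_mem_FP (coinR_mem_FP s) hR) ht
  unfold forcedB
  exact bxor_mem_CH (bdecide_mem_CH hval) (band_mem_CH (bconst_mem_CH _)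
    (bdecide_mem_CH (IsCHFn.eq_mem_CH hidx ((IsCHFn.of_FP iR_mem_FP).comp_FP hR))))

/-- **`Cons2 fl s s'` is a `CH` predicate.** [cite: AaronsonAmbainis2014, proof of Thm. 23 (p. 14)] -/
theorem cons2_mem_CH (fl : Bool) (s s' : ℕ) : ({R | Cons2 F fl s s' R} : Language Bool) ∈ CH := by
  -- level 2, on `z₂ = ⟨⟨R, bin t⟩, bin t'⟩`
  have hR2 : fstP ∘ fstP ∈ FP := comp_mem_FP fstP_mem_FP fstP_mem_FP
  have hx2 : xR ∘ fstP ∘ fstP ∈ FP := comp_mem_FP xR_mem_FP hR2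
  have ht2 : sndP ∘ fstP ∈ FP := comp_mem_FP sndP_mem_FP fstP_mem_FP
  obtain ⟨-, hread_s, -, -, hidx_s⟩ := pathAtoms_mem_CH hU hx2 (comp_mem_FP (coinR_mem_FP s) hR2) ht2
  obtain ⟨-, hread_s', -, -, hidx_s'⟩ := pathAtoms_mem_CH hU hx2 (comp_mem_FP (coinR_mem_FP s') hR2) sndP_mem_FP
  have hfree := free_mem_CH (comp_mem_FP rhoR_mem_FP hR2) hidx_s
  have hf_s := forcedB_mem_CH hU fl s hR2 ht2
  have hf_s' := forcedB_mem_CH hU fl s' hR2 sndP_mem_FP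
  have hbody2 := imp_mem_CH hread_s (imp_mem_CH hread_s' (imp_mem_CH hfree (imp_mem_CH (IsCHFn.eq_mem_CH hidx_s hidx_s')
    (beq_mem_CH hf_s hf_s'))))
  -- level 1, on `z₁ = ⟨R, bin t⟩`
  have hall1 := forall_lt_fn_mem_CH (Φ := fun z₁ t' =>
      PRead F (xR (fstP z₁)) (coinR s (fstP z₁)) (bitsToNat (sndP z₁)) → PRead F (xR (fstP z₁)) (coinR s' (fstP z₁)) t' →
        Free (rhoR (fstP z₁)) (PIdx F (xR (fstP z₁)) (coinR s (fstP z₁)) (bitsToNat (sndP z₁))) →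
          PIdx F (xR (fstP z₁)) (coinR s (fstP z₁)) (bitsToNat (sndP z₁)) = PIdx F (xR (fstP z₁)) (coinR s' (fstP z₁)) t' →
            forcedB F fl s (fstP z₁) (bitsToNat (sndP z₁)) = forcedB F fl s' (fstP z₁) t')
    (IsCHFn.length_FP (show dR ∘ fstP ∈ FP from comp_mem_FP (g := dR) dR_mem_FP fstP_mem_FP)) hbody2
  exact forall_lt_fn_mem_CH (Φ := fun R t => ∀ t' < (dR R).length, PRead F (xR R) (coinR s R) t → PRead F (xR R) (coinR s' R) t' →
      Free (rhoR R) (PIdx F (xR R) (coinR s R) t) → PIdx F (xR R) (coinR s R) t = PIdx F (xR R) (coinR s' R) t' →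
        forcedB F fl s R t = forcedB F fl s' R t') (IsCHFn.length_FP (t := dR) dR_mem_FP) hall1

/-- **`ConsAll` is a `CH` predicate.** [cite: AaronsonAmbainis2014, proof of Thm. 23 (p. 14)] -/
theorem consAll_mem_CH (fl : Bool) (σ : List ℕ) : ({R | ConsAll F fl σ R} : Language Bool) ∈ CH :=
  and_mem_CH (listAll_mem_CH σ fun s _ => cons1_mem_CH hU s)
    (listAll_mem_CH σ fun s _ => listAll_mem_CH σ fun s' _ => cons2_mem_CH hU fl s s')

/-- **`NewFree σ s` is a `CH` predicate** of `⟨R, bin t⟩`. [folklore] -/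
theorem newFree_mem_CH (σ : List ℕ) (s : ℕ) :
    ({z | NewFree F σ s (fstP z) (bitsToNat (sndP z))} : Language Bool) ∈ CH := by
  have hx1 : xR ∘ fstP ∈ FP := comp_mem_FP xR_mem_FP fstP_mem_FP
  obtain ⟨-, hread, -, -, hidx⟩ := pathAtoms_mem_CH hU hx1 (comp_mem_FP (coinR_mem_FP s) fstP_mem_FP) sndP_mem_FP
  have hfree := free_mem_CH (comp_mem_FP rhoR_mem_FP fstP_mem_FP) hidx
  -- third conjunct: for each `s' < s` in `σ`, `∀ t' < |d|, …` on `⟨⟨R, t⟩, t'⟩`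
  have hR2 : fstP ∘ fstP ∈ FP := comp_mem_FP fstP_mem_FP fstP_mem_FP
  have hx2 : xR ∘ fstP ∘ fstP ∈ FP := comp_mem_FP xR_mem_FP hR2
  obtain ⟨-, -, -, -, hidx2⟩ := pathAtoms_mem_CH hU hx2 (comp_mem_FP (coinR_mem_FP s) hR2) (comp_mem_FP sndP_mem_FP fstP_mem_FP)
  have hthird : ({z | ∀ s' ∈ σ, s' < s → ∀ t' < (dR (fstP z)).length, PRead F (xR (fstP z)) (coinR s' (fstP z)) t' →
      PIdx F (xR (fstP z)) (coinR s' (fstP z)) t' ≠ PIdx F (xR (fstP z)) (coinR s (fstP z)) (bitsToNat (sndP z))} : Language Bool) ∈ CH := by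
    refine listAll_mem_CH σ fun s' _ => ?_
    by_cases hs : s' < s
    · obtain ⟨-, hread', -, -, hidx'⟩ := pathAtoms_mem_CH hU hx2 (comp_mem_FP (coinR_mem_FP s') hR2) sndP_mem_FP
      have := forall_lt_fn_mem_CH (Φ := fun z t' => PRead F (xR (fstP z)) (coinR s' (fstP z)) t' →
          PIdx F (xR (fstP z)) (coinR s' (fstP z)) t' ≠ PIdx F (xR (fstP z)) (coinR s (fstP z)) (bitsToNat (sndP z)))
        (IsCHFn.length_FP (show dR ∘ fstP ∈ FP from comp_mem_FP (g := dR) dR_mem_FP fstP_mem_FP)) (imp_mem_CH hread' (not_mem_CH (IsCHFn.eq_mem_CH hidx' hidx2)))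
      exact mem_CH_of_iff this _ fun z => by
        change (s' < s → _) ↔ _; simp only [hs, forall_true_left]; rfl
    · exact mem_CH_of_iff top_mem_CH _ fun z => by
        change (s' < s → _) ↔ True; simp only [hs, IsEmpty.forall_iff]
  -- fourth conjunct: `∀ t' < t, …` on `⟨⟨R, t⟩, t'⟩`
  obtain ⟨-, hread'', -, -, hidx''⟩ := pathAtoms_mem_CH hU hx2 (comp_mem_FP (coinR_mem_FP s) hR2) sndP_mem_FP
  have hfourth := forall_lt_fn_mem_CH (Φ := fun z t' => PRead F (xR (fstP z)) (coinR s (fstP z)) t' →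
      PIdx F (xR (fstP z)) (coinR s (fstP z)) t' ≠ PIdx F (xR (fstP z)) (coinR s (fstP z)) (bitsToNat (sndP z)))
    (IsCHFn.of_FP sndP_mem_FP) (imp_mem_CH hread'' (not_mem_CH (IsCHFn.eq_mem_CH hidx'' hidx2)))
  exact and_mem_CH hread (and_mem_CH hfree (and_mem_CH hthird hfourth))

/-- **`FreeCnt σ` is a `CH`-graph function.** [cite: AaronsonAmbainis2014, proof of Thm. 23 (p. 14)] -/
theorem freeCnt_isCHFn (σ : List ℕ) : IsCHFn (FreeCnt F σ) := by
  classical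
  unfold FreeCnt
  refine listSum_isCHFn σ fun s _ => ?_
  have hlt : ({z | bitsToNat (sndP z) < (dR (fstP z)).length} : Language Bool) ∈ CH :=
    IsCHFn.lt_mem_CH (IsCHFn.of_FP sndP_mem_FP) (IsCHFn.length_FP (show dR ∘ fstP ∈ FP from comp_mem_FP (g := dR) dR_mem_FP fstP_mem_FP))
  exact IsCHFn.count (Φ := fun R t => t < (dR R).length ∧ NewFree F σ s R t) X (and_mem_CH hlt (newFree_mem_CH hU σ s))

/-- **The gate counts are `CH`-graph functions.** [folklore] -/
theorem counts_isCHFn : IsCHFn (NGates F) ∧ IsCHFn (NHad F) ∧ IsCHFn (NOrc F) := by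
  classical
  have hlt : ({z | bitsToNat (sndP z) < (dR (fstP z)).length} : Language Bool) ∈ CH :=
    IsCHFn.lt_mem_CH (IsCHFn.of_FP sndP_mem_FP) (IsCHFn.length_FP (show dR ∘ fstP ∈ FP from comp_mem_FP (g := dR) dR_mem_FP fstP_mem_FP))
  obtain ⟨hlive, hread, hhad, -, -⟩ := pathAtoms_mem_CH hU (comp_mem_FP xR_mem_FP fstP_mem_FP)
    (comp_mem_FP (coinR_mem_FP 0) fstP_mem_FP) sndP_mem_FP
  exact ⟨IsCHFn.count (Φ := fun R t => t < (dR R).length ∧ PLive F (xR R) (coinR 0 R) t) X (and_mem_CH hlt hlive),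
    IsCHFn.count (Φ := fun R t => t < (dR R).length ∧ PHad F (xR R) (coinR 0 R) t) X (and_mem_CH hlt hhad),
    IsCHFn.count (Φ := fun R t => t < (dR R).length ∧ PRead F (xR R) (coinR 0 R) t) X (and_mem_CH hlt hread)⟩

/-- `Meet s₀ s₁` is a `CH` predicate (indeed `P`). [folklore] -/
theorem meet_mem_CH (s₀ s₁ : ℕ) : ({R | Meet F s₀ s₁ R} : Language Bool) ∈ CH := by
  obtain ⟨_, hlab, -⟩ := atoms_mem_FP hU
  have hlabAt : ∀ s, (labF F ∘ pairFn xR (coinR s)) ∈ FP := fun s =>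
    comp_mem_FP (g := labF F) hlab (pairFn_mem_FP xR_mem_FP (coinR_mem_FP s))
  obtain ⟨hv0, ha0⟩ := finalAtoms_mem_CH hU xR_mem_FP (coinR_mem_FP s₀)
  obtain ⟨hv1, -⟩ := finalAtoms_mem_CH hU xR_mem_FP (coinR_mem_FP s₁)
  have heq : ({R | labF F (boolPair (xR R) (coinR s₀ R)) = labF F (boolPair (xR R) (coinR s₁ R))} : Language Bool) ∈ CH :=
    mem_CH_of_iff (P_subset_CH (fpEq_mem_P (hlabAt s₀) (hlabAt s₁))) _ fun R => by
      change labF F (boolPair (xR R) (coinR s₀ R)) = labF F (boolPair (xR R) (coinR s₁ R)) ↔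
        (labF F ∘ pairFn xR (coinR s₀)) R = (labF F ∘ pairFn xR (coinR s₁)) R
      simp only [Function.comp_apply, pairFn_apply]
  exact and_mem_CH hv0 (and_mem_CH hv1 (and_mem_CH heq ha0))

/-- `PhEq k s₀ s₁` is a `CH` predicate (indeed `P`). [folklore] -/
theorem phEq_mem_CH (k s₀ s₁ : ℕ) : ({R | PhEq F k s₀ s₁ R} : Language Bool) ∈ CH := by
  obtain ⟨_, _, _, hph, -⟩ := atoms_mem_FP hU
  have hphAt : ∀ k s, (phkF F k ∘ pairFn xR (coinR s)) ∈ FP := fun k s =>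
    comp_mem_FP (g := phkF F k) (hph k) (pairFn_mem_FP xR_mem_FP (coinR_mem_FP s))
  exact mem_CH_of_iff (P_subset_CH (fpEq_mem_P (hphAt 0 s₀) (hphAt k s₁))) _ fun R => by
    change phkF F 0 (boolPair (xR R) (coinR s₀ R)) = phkF F k (boolPair (xR R) (coinR s₁ R)) ↔
      (phkF F 0 ∘ pairFn xR (coinR s₀)) R = (phkF F k ∘ pairFn xR (coinR s₁)) R
    simp only [Function.comp_apply, pairFn_apply]

/-- `TPos`, `TNeg` are `CH` predicates. [folklore] -/
theorem tpos_tneg_mem_CH (b : Bool) (s₀ s₁ : ℕ) :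
    ({R | TPos F b s₀ s₁ R} : Language Bool) ∈ CH ∧ ({R | TNeg F b s₀ s₁ R} : Language Bool) ∈ CH := by
  cases b
  · exact ⟨and_mem_CH (meet_mem_CH hU s₀ s₁) (phEq_mem_CH hU 0 s₀ s₁), and_mem_CH (meet_mem_CH hU s₀ s₁) (phEq_mem_CH hU 4 s₀ s₁)⟩
  · exact ⟨and_mem_CH (meet_mem_CH hU s₀ s₁) (or_mem_CH (phEq_mem_CH hU 1 s₀ s₁) (phEq_mem_CH hU 7 s₀ s₁)),
      and_mem_CH (meet_mem_CH hU s₀ s₁) (or_mem_CH (phEq_mem_CH hU 3 s₀ s₁) (phEq_mem_CH hU 5 s₀ s₁))⟩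

/-- **`TSign κ pos` is a `CH` predicate.** [folklore] -/
theorem tsign_mem_CH (κ : Kind) (pos : Bool) : ({R | TSign F κ pos R} : Language Bool) ∈ CH := by
  obtain ⟨q, bX, bY, fl⟩ := κ
  obtain ⟨hpX, hnX⟩ := tpos_tneg_mem_CH hU bX 0 1
  obtain ⟨hpY, hnY⟩ := tpos_tneg_mem_CH hU bY 2 3
  cases q <;> cases pos
  · exact hnX
  · exact hpX
  · exact or_mem_CH (and_mem_CH hpX hnY) (and_mem_CH hnX hpY)
  · exact or_mem_CH (and_mem_CH hpX hpY) (and_mem_CH hnX hnY)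

omit hU in
/-- `NGates R ≤ |R|` (every counted `t` is below `|d| ≤ |R|`). [folklore] -/
theorem nGates_le (R : List Bool) : NGates F R ≤ R.length :=
  (card_filter_lt_le _ _ _).trans (length_dR_le R).1

/-- **`Guard` is a `CH` predicate.** [folklore] -/
theorem guard_mem_CH : ({R | Guard F R} : Language Bool) ∈ CH := by
  obtain ⟨hN, -, -⟩ := counts_isCHFn hU
  exact listAll_mem_CH [0, 1, 2, 3] fun s _ => IsCHFn.lt_mem_CH (IsCHFn.of_FP (coinR_mem_FP s))
    (hN.pow2 ⟨X, fun R => by rw [eval_X]; exact nGates_le (F := F) R⟩)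

/-- **The summand is a `CH`-graph function.** [cite: AaronsonAmbainis2014, proof of Thm. 23 (p. 14)] -/
theorem gSummand_isCHFn (κ : Kind) (pos : Bool) : IsCHFn (gSummand F κ pos) := by
  obtain ⟨hN, -, -⟩ := counts_isCHFn hU
  have hexp : IsCHFn fun R => κ.kfac * NGates F R - FreeCnt F κ.slots R := ((IsCHFn.const _).mul hN).tsub (freeCnt_isCHFn hU _)
  have hpow := hexp.pow2 ⟨C κ.kfac * X, fun R => by
    rw [eval_mul, eval_C, eval_X]
    exact (Nat.sub_le _ _).trans (Nat.mul_le_mul_left _ (nGates_le (F := F) R))⟩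
  exact IsCHFn.ite (and_mem_CH (guard_mem_CH hU) (and_mem_CH (tsign_mem_CH hU κ pos) (consAll_mem_CH hU κ.fl κ.slots))) hpow
    (IsCHFn.const 0)

/-- **The four nested sums are `CH`-graph functions.** [cite: AaronsonAmbainis2014, proof of Thm. 23 (p. 14: "computable in P^{#P}")] -/
theorem isCHFn_sumS (κ : Kind) (pos : Bool) :
    IsCHFn (sumS3 F κ pos) ∧ IsCHFn (sumS2 F κ pos) ∧ IsCHFn (sumS1 F κ pos) ∧ IsCHFn (sumS F κ pos) := by
  have h3 : IsCHFn (sumS3 F κ pos) := isCHFn_sum_pair (gSummand_isCHFn hU κ pos)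
  have h2 : IsCHFn (sumS2 F κ pos) := isCHFn_sum_pair h3
  have h1 : IsCHFn (sumS1 F κ pos) := isCHFn_sum_pair h2
  exact ⟨h3, h2, h1, isCHFn_sum_pair h1⟩

end Membership

end Thm23Machine

end Literature.Computability.QuantumComplexity

end
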